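import Summits.CriticalPhenomena.Ising3D.Control2DBoxCells
import Summits.CriticalPhenomena.Ising3D.Control2DL15OpeUBData37
import Summits.CriticalPhenomena.Ising3D.Control2DL15OpeUBData38
import Summits.CriticalPhenomena.Ising3D.Control2DL15OpeUBData39
import Summits.CriticalPhenomena.Ising3D.Control2DL15OpeUBData40
import Summits.CriticalPhenomena.Ising3D.Control2DL15OpeUBData41
import Summits.CriticalPhenomena.Ising3D.Control2DL15OpeUBData42
import Summits.CriticalPhenomena.Ising3D.Control2DL15OpeUBData43
import Summits.CriticalPhenomena.Ising3D.Control2DL15OpeUBData44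
import Summits.CriticalPhenomena.Ising3D.Control2DL15OpeUBRegion
import Summits.CriticalPhenomena.Ising3D.Control2DOpeCells
import Mathlib.Tactic.IntervalCases
import Mathlib.Tactic.Linarith
import Mathlib.Tactic.NormNum
import HarnessLib

/-!
# A kind-`ope2` (sense upper) 2D γ-certificate in the kernel: `p_T < 31259/2000000` at `Δ_σ = 1/8` under `A2D′` (Λ = 15)
(cell `pub-ising3x`, seat controls-1 gen 20; KERNEL PATH for the 2D γ-certificates, kind `ope2` — CONTROL-ONLY)

HONEST FRAMING: lottery ticket; floor = tightest certified 3D Ising CFT bounds; no exact-solution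
claim without a proof. CONTROL-ONLY: `d = 2`, global blocks, `Δ_σ = 1/8` exact, the 2D axiom set `A2D′` with the
CERTIFIED `ε` box `[49/50, 20001/20000]` as scalar input (scalars in the box `∪ [2, ∞)`, stress tensor at `(2,2)` + spin-2 gap `1`,
unitarity); nothing about `d = 3`.

**`opeUpper_2d_L15_opeUB : OpeUpperA2D (1/8) 2 1 (49 / 50) (20001 / 20000) (31259/2000000)`** — the total `(2,2)` coefficient obeys
`p_T < 31259/2000000` (by the Virasoro Ward identity `p_T = Δ_σ²/(2c)`: `c > 0.4998560`; cf. the HYPOTHESIS `hhi` of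
`cTwoSided_rb6_L15` in `Control2DOpeTwoSided`, which this theorem discharges) — from the RB-6 ope2 (sense upper) certificate `j136827_functional_deriv2d_L15_E040_sig1o8_ope2upper_P31259o2000000.json` (Λ = 15, E₀ = 40): p_T < 31259/2000000 at Δ_σ = 1/8 under A2D′ with the ε box [49/50, 20001/20000] (⇒ c > (1/8)²/(2·31259/2000000) = 0.4998560 by the Ward identity), with EVERY obligation re-decided
in the Lean kernel: (I′) and the `T` value as integer inequalities on `identZ`, the head of the spin-2 cell literal and
`denProdNat` (`opeUpper_half_of_cellsZ`, `Control2DOpeCells`), (R) by `region_of_kernelCertAuto`, cells `cells_opeUB`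
(one integer polynomial per spin from the literal library, Bernstein leaves). Zero grant compute. No facts, standard axioms only.

`cells_opeUB`: every cell obligation of the certificate ((E) on the ε box, (C′) scalars on [2, E₀), the stress-tensor point (T), spin 2 on [3, E₀), even spins ≥ 4 on [ℓ, E₀); E₀ = 40), in the witness form `∃ N ≥ E₀` with the spin's own truncation
order, from the kernel-decided Bernstein leaves of `Control2DL15OpeUBData*` via `cell_nonneg_of_bernCheck`. No facts, standard axioms only.

ONE MODULE for the cells theorem and the assembly (controls-1 g20): every gate dependency level waits for the farm's tree build to catch
up with the freshly landed imports (measured 1–2 h per level under load, `remote:stale:…:unbuilt`), so the cells theorem below is not a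
separate `…Cells` module as in the earlier replays; statements and proofs are unchanged.
-/

namespace Summit.CriticalPhenomena.Ising3D.Control2D

open Finset Set
open Literature.MathematicalPhysics.QuantumFieldTheory.ConformalBootstrap3D

set_option maxHeartbeats 0 in
set_option maxRecDepth 200000 in
/-- **The cells of the certificate** (p_T < 31259/2000000 at Δ_σ = 1/8 under A2D′ with the ε box [49/50, 20001/20000] (⇒ c > (1/8)²/(2·31259/2000000) = 0.4998560 by the Ward identity); `E₀ = 40`; truncation `N = Nd + 1` per spin:
ℓ=0: 56, ℓ=2: 56, ℓ=4: 56, ℓ=6: 48, ℓ=8: 56, ℓ=10: 48 ; others `N = 40`). [folklore] -/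
theorem cells_opeUB :
    BoxCellsN slL15.toFinset (fun p => (wtopeUB p : ℝ)) (1 / 8) 2 1 (49 / 50) (20001 / 20000) 40 := by
  refine ⟨?_, ?_, ?_, ?_, ?_⟩
  · intro Δ h1 h2
    refine ⟨55 + 1, by norm_num, ?_⟩
    exact cell_nonneg_of_bernAuto_trunc wtopeUB slL15_nodup slL15_deg 0 55 359 (q := 40000) (a := 19600) (L := 401) (by norm_num) (by norm_num) (by norm_num) (by rw [phatopeUBs0_eq]; exact cellChk_opeUB_s0l0) (by norm_num; linarith) (by norm_num; linarith)
  · intro Δ h1 h2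
    replace h2 := h2.le
    refine ⟨55 + 1, by norm_num, ?_⟩
    rcases le_or_gt Δ ((51 : ℝ) / 16) with hd0 | hd0
    · exact cell_nonneg_of_bernAuto_trunc wtopeUB slL15_nodup slL15_deg 0 55 359 (q := 32) (a := 32) (L := 19) (by norm_num) (by norm_num) (by norm_num) (by rw [phatopeUBs0_eq]; exact cellChk_opeUB_s0l1) (by norm_num; linarith) (by norm_num; linarith)
    rcases le_or_gt Δ ((121 : ℝ) / 32) with hd1 | hd1
    · exact cell_nonneg_of_bernAuto_trunc wtopeUB slL15_nodup slL15_deg 0 55 359 (q := 64) (a := 102) (L := 19) (by norm_num) (by norm_num) (by norm_num) (by rw [phatopeUBs0_eq]; exact cellChk_opeUB_s0l2) (by norm_num; linarith) (by norm_num; linarith)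
    rcases le_or_gt Δ ((261 : ℝ) / 64) with hd2 | hd2
    · exact cell_nonneg_of_bernAuto_trunc wtopeUB slL15_nodup slL15_deg 0 55 359 (q := 128) (a := 242) (L := 19) (by norm_num) (by norm_num) (by norm_num) (by rw [phatopeUBs0_eq]; exact cellChk_opeUB_s0l3) (by norm_num; linarith) (by norm_num; linarith)
    rcases le_or_gt Δ ((35 : ℝ) / 8) with hd3 | hd3
    · exact cell_nonneg_of_bernAuto_trunc wtopeUB slL15_nodup slL15_deg 0 55 359 (q := 128) (a := 261) (L := 19) (by norm_num) (by norm_num) (by norm_num) (by rw [phatopeUBs0_eq]; exact cellChk_opeUB_s0l4) (by norm_num; linarith) (by norm_num; linarith)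
    rcases le_or_gt Δ ((27 : ℝ) / 4) with hd4 | hd4
    · exact cell_nonneg_of_bernAuto_trunc wtopeUB slL15_nodup slL15_deg 0 55 359 (q := 16) (a := 35) (L := 19) (by norm_num) (by norm_num) (by norm_num) (by rw [phatopeUBs0_eq]; exact cellChk_opeUB_s0l5) (by norm_num; linarith) (by norm_num; linarith)
    rcases le_or_gt Δ ((127 : ℝ) / 16) with hd5 | hd5
    · exact cell_nonneg_of_bernAuto_trunc wtopeUB slL15_nodup slL15_deg 0 55 359 (q := 32) (a := 108) (L := 19) (by norm_num) (by norm_num) (by norm_num) (by rw [phatopeUBs0_eq]; exact cellChk_opeUB_s0l6) (by norm_num; linarith) (by norm_num; linarith)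
    rcases le_or_gt Δ ((273 : ℝ) / 32) with hd6 | hd6
    · exact cell_nonneg_of_bernAuto_trunc wtopeUB slL15_nodup slL15_deg 0 55 359 (q := 64) (a := 254) (L := 19) (by norm_num) (by norm_num) (by norm_num) (by rw [phatopeUBs0_eq]; exact cellChk_opeUB_s0l7) (by norm_num; linarith) (by norm_num; linarith)
    rcases le_or_gt Δ ((565 : ℝ) / 64) with hd7 | hd7
    · exact cell_nonneg_of_bernAuto_trunc wtopeUB slL15_nodup slL15_deg 0 55 359 (q := 128) (a := 546) (L := 19) (by norm_num) (by norm_num) (by norm_num) (by rw [phatopeUBs0_eq]; exact cellChk_opeUB_s0l8) (by norm_num; linarith) (by norm_num; linarith)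
    rcases le_or_gt Δ ((73 : ℝ) / 8) with hd8 | hd8
    · exact cell_nonneg_of_bernAuto_trunc wtopeUB slL15_nodup slL15_deg 0 55 349 (q := 128) (a := 565) (L := 19) (by norm_num) (by norm_num) (by norm_num) (by rw [phatopeUBs0_eq]; exact cellChk_opeUB_s0l9) (by norm_num; linarith) (by norm_num; linarith)
    rcases le_or_gt Δ ((23 : ℝ) / 2) with hd9 | hd9
    · exact cell_nonneg_of_bernAuto_trunc wtopeUB slL15_nodup slL15_deg 0 55 359 (q := 16) (a := 73) (L := 19) (by norm_num) (by norm_num) (by norm_num) (by rw [phatopeUBs0_eq]; exact cellChk_opeUB_s0l10) (by norm_num; linarith) (by norm_num; linarith)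
    rcases le_or_gt Δ (21 : ℝ) with hd10 | hd10
    · exact cell_nonneg_of_bernAuto_trunc wtopeUB slL15_nodup slL15_deg 0 55 359 (q := 4) (a := 23) (L := 19) (by norm_num) (by norm_num) (by norm_num) (by rw [phatopeUBs0_eq]; exact cellChk_opeUB_s0l11) (by norm_num; linarith) (by norm_num; linarith)
    exact cell_nonneg_of_bernAuto_trunc wtopeUB slL15_nodup slL15_deg 0 55 359 (q := 2) (a := 21) (L := 19) (by norm_num) (by norm_num) (by norm_num) (by rw [phatopeUBs0_eq]; exact cellChk_opeUB_s0l12) (by norm_num; linarith) (by norm_num; linarith)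
  · refine ⟨55 + 1, by norm_num, ?_⟩
    exact cell_nonneg_of_bernAuto_trunc wtopeUB slL15_nodup slL15_deg 2 55 366 (q := 1) (a := 0) (L := 0) (by norm_num) (by norm_num) (by norm_num) (by rw [phatopeUBs2_eq]; exact cellChk_opeUB_s2l0) (by norm_num) (by norm_num)
  · intro Δ h1 h2
    replace h1 : (3 : ℝ) ≤ Δ := by linarith
    replace h2 := h2.le
    refine ⟨55 + 1, by norm_num, ?_⟩
    rcases le_or_gt Δ ((85 : ℝ) / 16) with hd0 | hd0
    · exact cell_nonneg_of_bernAuto_trunc wtopeUB slL15_nodup slL15_deg 2 55 366 (q := 32) (a := 16) (L := 37) (by norm_num) (by norm_num) (by norm_num) (by rw [phatopeUBs2_eq]; exact cellChk_opeUB_s2l1) (by norm_num; linarith) (by norm_num; linarith)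
    rcases le_or_gt Δ ((377 : ℝ) / 64) with hd1 | hd1
    · exact cell_nonneg_of_bernAuto_trunc wtopeUB slL15_nodup slL15_deg 2 55 366 (q := 128) (a := 212) (L := 37) (by norm_num) (by norm_num) (by norm_num) (by rw [phatopeUBs2_eq]; exact cellChk_opeUB_s2l2) (by norm_num; linarith) (by norm_num; linarith)
    rcases le_or_gt Δ ((207 : ℝ) / 32) with hd2 | hd2
    · exact cell_nonneg_of_bernAuto_trunc wtopeUB slL15_nodup slL15_deg 2 55 366 (q := 128) (a := 249) (L := 37) (by norm_num) (by norm_num) (by norm_num) (by rw [phatopeUBs2_eq]; exact cellChk_opeUB_s2l3) (by norm_num; linarith) (by norm_num; linarith)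
    rcases le_or_gt Δ ((61 : ℝ) / 8) with hd3 | hd3
    · exact cell_nonneg_of_bernAuto_trunc wtopeUB slL15_nodup slL15_deg 2 55 366 (q := 64) (a := 143) (L := 37) (by norm_num) (by norm_num) (by norm_num) (by rw [phatopeUBs2_eq]; exact cellChk_opeUB_s2l4) (by norm_num; linarith) (by norm_num; linarith)
    rcases le_or_gt Δ ((49 : ℝ) / 4) with hd4 | hd4
    · exact cell_nonneg_of_bernAuto_trunc wtopeUB slL15_nodup slL15_deg 2 55 366 (q := 16) (a := 45) (L := 37) (by norm_num) (by norm_num) (by norm_num) (by rw [phatopeUBs2_eq]; exact cellChk_opeUB_s2l5) (by norm_num; linarith) (by norm_num; linarith)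
    rcases le_or_gt Δ ((43 : ℝ) / 2) with hd5 | hd5
    · exact cell_nonneg_of_bernAuto_trunc wtopeUB slL15_nodup slL15_deg 2 55 366 (q := 8) (a := 41) (L := 37) (by norm_num) (by norm_num) (by norm_num) (by rw [phatopeUBs2_eq]; exact cellChk_opeUB_s2l6) (by norm_num; linarith) (by norm_num; linarith)
    exact cell_nonneg_of_bernAuto_trunc wtopeUB slL15_nodup slL15_deg 2 55 366 (q := 4) (a := 39) (L := 37) (by norm_num) (by norm_num) (by norm_num) (by rw [phatopeUBs2_eq]; exact cellChk_opeUB_s2l7) (by norm_num; linarith) (by norm_num; linarith)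
  · intro ℓ hℓ hℓ0 hℓ2 Δ hℓΔ hΔ
    have hℓR : (ℓ : ℝ) < 40 := lt_of_le_of_lt hℓΔ hΔ
    have hℓE : ℓ < 40 := by exact_mod_cast hℓR
    replace h2 := hΔ.le
    interval_cases ℓ
    · exact absurd rfl hℓ0
    · exact absurd hℓ (by decide)
    · exact absurd rfl hℓ2
    · exact absurd hℓ (by decide)
    · have h1 : (4 : ℝ) ≤ Δ := by exact_mod_cast hℓΔ
      refine ⟨55 + 1, by norm_num, ?_⟩
      rcases le_or_gt Δ ((25 : ℝ) / 4) with hd0 | hd0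
      · exact cell_nonneg_of_bernAuto_trunc wtopeUB slL15_nodup slL15_deg 4 55 369 (q := 8) (a := 0) (L := 9) (by norm_num) (by norm_num) (by norm_num) (by rw [phatopeUBs4_eq]; exact cellChk_opeUB_s4l0) (by norm_num; linarith) (by norm_num; linarith)
      rcases le_or_gt Δ ((17 : ℝ) / 2) with hd1 | hd1
      · exact cell_nonneg_of_bernAuto_trunc wtopeUB slL15_nodup slL15_deg 4 55 369 (q := 8) (a := 9) (L := 9) (by norm_num) (by norm_num) (by norm_num) (by rw [phatopeUBs4_eq]; exact cellChk_opeUB_s4l1) (by norm_num; linarith) (by norm_num; linarith)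
      rcases le_or_gt Δ (13 : ℝ) with hd2 | hd2
      · exact cell_nonneg_of_bernAuto_trunc wtopeUB slL15_nodup slL15_deg 4 55 369 (q := 4) (a := 9) (L := 9) (by norm_num) (by norm_num) (by norm_num) (by rw [phatopeUBs4_eq]; exact cellChk_opeUB_s4l2) (by norm_num; linarith) (by norm_num; linarith)
      rcases le_or_gt Δ (22 : ℝ) with hd3 | hd3
      · exact cell_nonneg_of_bernAuto_trunc wtopeUB slL15_nodup slL15_deg 4 55 369 (q := 2) (a := 9) (L := 9) (by norm_num) (by norm_num) (by norm_num) (by rw [phatopeUBs4_eq]; exact cellChk_opeUB_s4l3) (by norm_num; linarith) (by norm_num; linarith)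
      exact cell_nonneg_of_bernAuto_trunc wtopeUB slL15_nodup slL15_deg 4 55 369 (q := 1) (a := 9) (L := 9) (by norm_num) (by norm_num) (by norm_num) (by rw [phatopeUBs4_eq]; exact cellChk_opeUB_s4l4) (by norm_num; linarith) (by norm_num; linarith)
    · exact absurd hℓ (by decide)
    · have h1 : (6 : ℝ) ≤ Δ := by exact_mod_cast hℓΔ
      refine ⟨47 + 1, by norm_num, ?_⟩
      rcases le_or_gt Δ ((65 : ℝ) / 8) with hd0 | hd0
      · exact cell_nonneg_of_bernAuto_trunc wtopeUB slL15_nodup slL15_deg 6 47 314 (q := 16) (a := 0) (L := 17) (by norm_num) (by norm_num) (by norm_num) (by rw [phatopeUBs6_eq]; exact cellChk_opeUB_s6l0) (by norm_num; linarith) (by norm_num; linarith)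
      rcases le_or_gt Δ ((41 : ℝ) / 4) with hd1 | hd1
      · exact cell_nonneg_of_bernAuto_trunc wtopeUB slL15_nodup slL15_deg 6 47 314 (q := 16) (a := 17) (L := 17) (by norm_num) (by norm_num) (by norm_num) (by rw [phatopeUBs6_eq]; exact cellChk_opeUB_s6l1) (by norm_num; linarith) (by norm_num; linarith)
      rcases le_or_gt Δ ((29 : ℝ) / 2) with hd2 | hd2
      · exact cell_nonneg_of_bernAuto_trunc wtopeUB slL15_nodup slL15_deg 6 47 314 (q := 8) (a := 17) (L := 17) (by norm_num) (by norm_num) (by norm_num) (by rw [phatopeUBs6_eq]; exact cellChk_opeUB_s6l2) (by norm_num; linarith) (by norm_num; linarith)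
      rcases le_or_gt Δ (23 : ℝ) with hd3 | hd3
      · exact cell_nonneg_of_bernAuto_trunc wtopeUB slL15_nodup slL15_deg 6 47 314 (q := 4) (a := 17) (L := 17) (by norm_num) (by norm_num) (by norm_num) (by rw [phatopeUBs6_eq]; exact cellChk_opeUB_s6l3) (by norm_num; linarith) (by norm_num; linarith)
      exact cell_nonneg_of_bernAuto_trunc wtopeUB slL15_nodup slL15_deg 6 47 314 (q := 2) (a := 17) (L := 17) (by norm_num) (by norm_num) (by norm_num) (by rw [phatopeUBs6_eq]; exact cellChk_opeUB_s6l4) (by norm_num; linarith) (by norm_num; linarith)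
    · exact absurd hℓ (by decide)
    · have h1 : (8 : ℝ) ≤ Δ := by exact_mod_cast hℓΔ
      refine ⟨55 + 1, by norm_num, ?_⟩
      rcases le_or_gt Δ (10 : ℝ) with hd0 | hd0
      · exact cell_nonneg_of_bernAuto_trunc wtopeUB slL15_nodup slL15_deg 8 55 378 (q := 1) (a := 0) (L := 1) (by norm_num) (by norm_num) (by norm_num) (by rw [phatopeUBs8_eq]; exact cellChk_opeUB_s8l0) (by norm_num; linarith) (by norm_num; linarith)
      rcases le_or_gt Δ (12 : ℝ) with hd1 | hd1
      · exact cell_nonneg_of_bernAuto_trunc wtopeUB slL15_nodup slL15_deg 8 55 378 (q := 1) (a := 1) (L := 1) (by norm_num) (by norm_num) (by norm_num) (by rw [phatopeUBs8_eq]; exact cellChk_opeUB_s8l1) (by norm_num; linarith) (by norm_num; linarith)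
      rcases le_or_gt Δ (16 : ℝ) with hd2 | hd2
      · exact cell_nonneg_of_bernAuto_trunc wtopeUB slL15_nodup slL15_deg 8 55 378 (q := 1) (a := 2) (L := 2) (by norm_num) (by norm_num) (by norm_num) (by rw [phatopeUBs8_eq]; exact cellChk_opeUB_s8l2) (by norm_num; linarith) (by norm_num; linarith)
      rcases le_or_gt Δ (24 : ℝ) with hd3 | hd3
      · exact cell_nonneg_of_bernAuto_trunc wtopeUB slL15_nodup slL15_deg 8 55 378 (q := 1) (a := 4) (L := 4) (by norm_num) (by norm_num) (by norm_num) (by rw [phatopeUBs8_eq]; exact cellChk_opeUB_s8l3) (by norm_num; linarith) (by norm_num; linarith)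
      exact cell_nonneg_of_bernAuto_trunc wtopeUB slL15_nodup slL15_deg 8 55 378 (q := 1) (a := 8) (L := 8) (by norm_num) (by norm_num) (by norm_num) (by rw [phatopeUBs8_eq]; exact cellChk_opeUB_s8l4) (by norm_num; linarith) (by norm_num; linarith)
    · exact absurd hℓ (by decide)
    · have h1 : (10 : ℝ) ≤ Δ := by exact_mod_cast hℓΔ
      refine ⟨47 + 1, by norm_num, ?_⟩
      rcases le_or_gt Δ ((95 : ℝ) / 8) with hd0 | hd0
      · exact cell_nonneg_of_bernAuto_trunc wtopeUB slL15_nodup slL15_deg 10 47 320 (q := 16) (a := 0) (L := 15) (by norm_num) (by norm_num) (by norm_num) (by rw [phatopeUBs10_eq]; exact cellChk_opeUB_s10l0) (by norm_num; linarith) (by norm_num; linarith)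
      rcases le_or_gt Δ ((55 : ℝ) / 4) with hd1 | hd1
      · exact cell_nonneg_of_bernAuto_trunc wtopeUB slL15_nodup slL15_deg 10 47 320 (q := 16) (a := 15) (L := 15) (by norm_num) (by norm_num) (by norm_num) (by rw [phatopeUBs10_eq]; exact cellChk_opeUB_s10l1) (by norm_num; linarith) (by norm_num; linarith)
      rcases le_or_gt Δ ((35 : ℝ) / 2) with hd2 | hd2
      · exact cell_nonneg_of_bernAuto_trunc wtopeUB slL15_nodup slL15_deg 10 47 320 (q := 8) (a := 15) (L := 15) (by norm_num) (by norm_num) (by norm_num) (by rw [phatopeUBs10_eq]; exact cellChk_opeUB_s10l2) (by norm_num; linarith) (by norm_num; linarith)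
      rcases le_or_gt Δ (25 : ℝ) with hd3 | hd3
      · exact cell_nonneg_of_bernAuto_trunc wtopeUB slL15_nodup slL15_deg 10 47 320 (q := 4) (a := 15) (L := 15) (by norm_num) (by norm_num) (by norm_num) (by rw [phatopeUBs10_eq]; exact cellChk_opeUB_s10l3) (by norm_num; linarith) (by norm_num; linarith)
      exact cell_nonneg_of_bernAuto_trunc wtopeUB slL15_nodup slL15_deg 10 47 320 (q := 2) (a := 15) (L := 15) (by norm_num) (by norm_num) (by norm_num) (by rw [phatopeUBs10_eq]; exact cellChk_opeUB_s10l4) (by norm_num; linarith) (by norm_num; linarith)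
    · exact absurd hℓ (by decide)
    · have h1 : (12 : ℝ) ≤ Δ := by exact_mod_cast hℓΔ
      refine ⟨39 + 1, by norm_num, ?_⟩
      exact cell_nonneg_of_bernAuto_trunc wtopeUB slL15_nodup slL15_deg 12 39 265 (q := 1) (a := 0) (L := 14) (by norm_num) (by norm_num) (by norm_num) (by rw [phatopeUBs12_eq]; exact cellChk_opeUB_s12l0) (by norm_num; linarith) (by norm_num; linarith)
    · exact absurd hℓ (by decide)
    · have h1 : (14 : ℝ) ≤ Δ := by exact_mod_cast hℓΔ
      refine ⟨39 + 1, by norm_num, ?_⟩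
      exact cell_nonneg_of_bernAuto_trunc wtopeUB slL15_nodup slL15_deg 14 39 268 (q := 1) (a := 0) (L := 13) (by norm_num) (by norm_num) (by norm_num) (by rw [phatopeUBs14_eq]; exact cellChk_opeUB_s14l0) (by norm_num; linarith) (by norm_num; linarith)
    · exact absurd hℓ (by decide)
    · have h1 : (16 : ℝ) ≤ Δ := by exact_mod_cast hℓΔ
      refine ⟨39 + 1, by norm_num, ?_⟩
      exact cell_nonneg_of_bernAuto_trunc wtopeUB slL15_nodup slL15_deg 16 39 271 (q := 1) (a := 0) (L := 12) (by norm_num) (by norm_num) (by norm_num) (by rw [phatopeUBs16_eq]; exact cellChk_opeUB_s16l0) (by norm_num; linarith) (by norm_num; linarith)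
    · exact absurd hℓ (by decide)
    · have h1 : (18 : ℝ) ≤ Δ := by exact_mod_cast hℓΔ
      refine ⟨39 + 1, by norm_num, ?_⟩
      exact cell_nonneg_of_bernAuto_trunc wtopeUB slL15_nodup slL15_deg 18 39 273 (q := 1) (a := 0) (L := 11) (by norm_num) (by norm_num) (by norm_num) (by rw [phatopeUBs18_eq]; exact cellChk_opeUB_s18l0) (by norm_num; linarith) (by norm_num; linarith)
    · exact absurd hℓ (by decide)
    · have h1 : (20 : ℝ) ≤ Δ := by exact_mod_cast hℓΔ
      refine ⟨39 + 1, by norm_num, ?_⟩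
      exact cell_nonneg_of_bernAuto_trunc wtopeUB slL15_nodup slL15_deg 20 39 275 (q := 1) (a := 0) (L := 10) (by norm_num) (by norm_num) (by norm_num) (by rw [phatopeUBs20_eq]; exact cellChk_opeUB_s20l0) (by norm_num; linarith) (by norm_num; linarith)
    · exact absurd hℓ (by decide)
    · have h1 : (22 : ℝ) ≤ Δ := by exact_mod_cast hℓΔ
      refine ⟨39 + 1, by norm_num, ?_⟩
      exact cell_nonneg_of_bernAuto_trunc wtopeUB slL15_nodup slL15_deg 22 39 277 (q := 1) (a := 0) (L := 9) (by norm_num) (by norm_num) (by norm_num) (by rw [phatopeUBs22_eq]; exact cellChk_opeUB_s22l0) (by norm_num; linarith) (by norm_num; linarith)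
    · exact absurd hℓ (by decide)
    · have h1 : (24 : ℝ) ≤ Δ := by exact_mod_cast hℓΔ
      refine ⟨39 + 1, by norm_num, ?_⟩
      exact cell_nonneg_of_bernAuto_trunc wtopeUB slL15_nodup slL15_deg 24 39 279 (q := 1) (a := 0) (L := 8) (by norm_num) (by norm_num) (by norm_num) (by rw [phatopeUBs24_eq]; exact cellChk_opeUB_s24l0) (by norm_num; linarith) (by norm_num; linarith)
    · exact absurd hℓ (by decide)
    · have h1 : (26 : ℝ) ≤ Δ := by exact_mod_cast hℓΔ
      refine ⟨39 + 1, by norm_num, ?_⟩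
      exact cell_nonneg_of_bernAuto_trunc wtopeUB slL15_nodup slL15_deg 26 39 281 (q := 1) (a := 0) (L := 7) (by norm_num) (by norm_num) (by norm_num) (by rw [phatopeUBs26_eq]; exact cellChk_opeUB_s26l0) (by norm_num; linarith) (by norm_num; linarith)
    · exact absurd hℓ (by decide)
    · have h1 : (28 : ℝ) ≤ Δ := by exact_mod_cast hℓΔ
      refine ⟨39 + 1, by norm_num, ?_⟩
      exact cell_nonneg_of_bernAuto_trunc wtopeUB slL15_nodup slL15_deg 28 39 282 (q := 1) (a := 0) (L := 6) (by norm_num) (by norm_num) (by norm_num) (by rw [phatopeUBs28_eq]; exact cellChk_opeUB_s28l0) (by norm_num; linarith) (by norm_num; linarith)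
    · exact absurd hℓ (by decide)
    · have h1 : (30 : ℝ) ≤ Δ := by exact_mod_cast hℓΔ
      refine ⟨39 + 1, by norm_num, ?_⟩
      exact cell_nonneg_of_bernAuto_trunc wtopeUB slL15_nodup slL15_deg 30 39 284 (q := 1) (a := 0) (L := 5) (by norm_num) (by norm_num) (by norm_num) (by rw [phatopeUBs30_eq]; exact cellChk_opeUB_s30l0) (by norm_num; linarith) (by norm_num; linarith)
    · exact absurd hℓ (by decide)
    · have h1 : (32 : ℝ) ≤ Δ := by exact_mod_cast hℓΔ
      refine ⟨39 + 1, by norm_num, ?_⟩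
      exact cell_nonneg_of_bernAuto_trunc wtopeUB slL15_nodup slL15_deg 32 39 286 (q := 1) (a := 0) (L := 4) (by norm_num) (by norm_num) (by norm_num) (by rw [phatopeUBs32_eq]; exact cellChk_opeUB_s32l0) (by norm_num; linarith) (by norm_num; linarith)
    · exact absurd hℓ (by decide)
    · have h1 : (34 : ℝ) ≤ Δ := by exact_mod_cast hℓΔ
      refine ⟨39 + 1, by norm_num, ?_⟩
      exact cell_nonneg_of_bernAuto_trunc wtopeUB slL15_nodup slL15_deg 34 39 287 (q := 1) (a := 0) (L := 3) (by norm_num) (by norm_num) (by norm_num) (by rw [phatopeUBs34_eq]; exact cellChk_opeUB_s34l0) (by norm_num; linarith) (by norm_num; linarith)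
    · exact absurd hℓ (by decide)
    · have h1 : (36 : ℝ) ≤ Δ := by exact_mod_cast hℓΔ
      refine ⟨39 + 1, by norm_num, ?_⟩
      exact cell_nonneg_of_bernAuto_trunc wtopeUB slL15_nodup slL15_deg 36 39 288 (q := 1) (a := 0) (L := 2) (by norm_num) (by norm_num) (by norm_num) (by rw [phatopeUBs36_eq]; exact cellChk_opeUB_s36l0) (by norm_num; linarith) (by norm_num; linarith)
    · exact absurd hℓ (by decide)
    · have h1 : (38 : ℝ) ≤ Δ := by exact_mod_cast hℓΔ
      refine ⟨39 + 1, by norm_num, ?_⟩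
      exact cell_nonneg_of_bernAuto_trunc wtopeUB slL15_nodup slL15_deg 38 39 290 (q := 1) (a := 0) (L := 1) (by norm_num) (by norm_num) (by norm_num) (by rw [phatopeUBs38_eq]; exact cellChk_opeUB_s38l0) (by norm_num; linarith) (by norm_num; linarith)
    · exact absurd hℓ (by decide)

/-- **2D control, γ-architecture, kind `ope2` (upper sense), kernel-complete: under `A2D′` at `Δ_σ = 1/8` with the `ε` box
`[49/50, 20001/20000]`, `p_T < 31259/2000000`**, every obligation of the Λ = 15 functional checked in the Lean kernel. CONTROL-ONLY (d = 2).
[cite: RattazziEtAl2008, §5.5] -/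
theorem opeUpper_2d_L15_opeUB : OpeUpperA2D (1 / 8 : ℝ) 2 1 (49 / 50) (20001 / 20000) (31259 / 2000000) := by
  have h := opeUpper_half_of_cellsZ wtopeUB slL15_nodup slL15_deg (G := 2) (δ := 1) (e₁ := 49 / 50) (e₂ := 20001 / 20000)
    (E₀ := 40) (Pn := 31259) (Pd := 2000000) (Nd := 55) (by norm_num) (by norm_num) (by norm_num) (by norm_num)
    (by norm_num) (by norm_num) (by rw [phatopeUBs2_eq]; decide +kernel) (by rw [phatopeUBs2_eq]; decide +kernel)
    (region_of_kernelCertAuto wtopeUB slL15_nodup slL15_deg 15 16 (by norm_num) (by norm_num) PregopeUB_eq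
      (by decide +kernel) QhatopeUB_eq _ cregopeUB_n0 cregJopeUB (by decide) cregJopeUB_ok) cells_opeUB
  push_cast at h
  exact h

/-- **The `c` lower edge this certificate puts on the kernel** (by the Virasoro Ward identity `p_T = Δ_σ²/(2c)`, taken as a
HYPOTHESIS on the datum exactly as in `cTwoSided_rb6_L15`): every parity-symmetric unitary solution of the 2D sum rule at `Δ_σ = 1/8`
under `A2D′` with the `ε` box `[49/50, 20001/20000]` whose total `(2,2)` coefficient equals `(1/8)²/(2c)` with `c > 0` has
`(1/8)²/(2·(31259/2000000)) < c`, i.e. `c > 15625/31259 ≈ 0.4998560`. CONTROL-ONLY (d = 2). [cite: RattazziEtAl2008, §5] -/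
theorem cLower_2d_L15_opeUB {D : CrossingData} (hU : D.IsUnitary) (hC : D.SatisfiesCrossing (1 / 8))
    (hS : D.ScalarsIn (Icc (49 / 50 : ℝ) (20001 / 20000) ∪ Ici 2)) (hT2 : D.SpinTwoIn ({2} ∪ Ici (2 + 1)))
    {c : ℝ} (hc : 0 < c) (hWard : D.stressCoeff = (1 / 8 : ℝ) ^ 2 / (2 * c)) :
    (1 / 8 : ℝ) ^ 2 / (2 * (31259 / 2000000)) < c :=
  centralCharge_lower_bound hc hWard (opeUpper_2d_L15_opeUB D hU hC hS hT2)

end Summit.CriticalPhenomena.Ising3D.Control2D
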